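import Summits.Schanuel.Schanuel.Theorems.ZilberEacBoundedBranchDensity
import HarnessLib

/-!
# Arbitrary base branches, LXVIII (a): bounded branches for curves of ANY positive `x₁`-degree —
# the hypothesis "`C` is not a horizontal line" replaces "`deg_{x₁} F ≥ 2`"

HONEST FRAMING.  Cell `pub-schanuel` (Zilber's Exponential-Algebraic Closedness, case ladder;
host summit Schanuel), seat 2, gen 31.  Files LXVI–LXVII used `deg_{x₁} F ≥ 2` twice: to exclude
that the irreducible `F` is a horizontal line (in the elimination) and to see that the bounded
branch is not constant.  Both only need "`C` contains no horizontal line" (`∀ a ∃ c, F(c, a) ≠ 0`),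
so the engine extends to curves of `x₁`-degree `1` — the graphs `x₁ = β(x₀)/α(x₀)` of rational
functions bounded at infinity that are not constant.  This matters for file LXVIII (b): the
transport of a curve of `x₁`-degree `≥ 2` by a lattice change of coordinates may have `x₁'`-degree
`1`.  Contents: `exists_eliminant_of_not_horizontal`, `not_eventually_relation_exp_boundedBranch'`,
**`unprojectedDense_boundedBranch'`** (the engine of file LXVII under the weaker hypotheses).
(The horizontal LINE `x₁ = θ` itself must be excluded: there `y₁ = e^θ` on every exponential point.)
Decided instances of an OPEN question (Mantova–Masser, PLMS 2024 §1 p. 5); EC(3,2) OPEN; NOT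
Schanuel's conjecture (neither used nor implied); EAC ⇏ SC.
-/

noncomputable section

open Filter Topology Set Complex Polynomial
open Literature.NumberTheory.Transcendental Literature.ModelTheory.Zilber
open Literature.ModelTheory.ExponentialFields

set_option linter.dupNamespace false

namespace Summit.Schanuel.Schanuel.Theorems

section BoundedBranchGeneral

variable (F : ℂ[X][X])

/-! ## Part A. Elimination without the degree hypothesis -/

/-- **Elimination of `x₀`, for `F` irreducible of positive `x₁`-degree containing no horizontal
line** (file LXVI's `exists_eliminant` verbatim otherwise). [folklore (the resultant)] -/
theorem exists_eliminant_of_not_horizontal (H : ℂ[X][X]) (hFirr : Irreducible F)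
    (hF1 : 1 ≤ F.natDegree)
    (hFh : ∀ a : ℂ, ∃ c : ℂ, (F.map (Polynomial.evalRingHom c)).eval a ≠ 0)
    (hH : H ≠ 0) (f g : Polynomial (ℂ[X][X]))
    (hf : ∀ a b c : ℂ, (f.map ((Polynomial.evalRingHom b).comp
      (Polynomial.mapRingHom (Polynomial.evalRingHom a)))).eval c =
      (F.map (Polynomial.evalRingHom c)).eval a)
    (hg : ∀ a b c : ℂ, (g.map ((Polynomial.evalRingHom b).comp
      (Polynomial.mapRingHom (Polynomial.evalRingHom a)))).eval c =
      (H.map (Polynomial.evalRingHom c)).eval b) :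
    ∃ D : ℂ[X][X], D ≠ 0 ∧ ∀ a b c : ℂ, (F.map (Polynomial.evalRingHom c)).eval a = 0 →
      (H.map (Polynomial.evalRingHom c)).eval b = 0 → (D.map (Polynomial.evalRingHom a)).eval b = 0 := by
  classical
  -- notation for the specialisation `(x₁, y₁) = (a, b)`
  set φ : ℂ → ℂ → (ℂ[X][X] →+* ℂ) := fun a b =>
    (Polynomial.evalRingHom b).comp (Polynomial.mapRingHom (Polynomial.evalRingHom a)) with hφ
  have hφev : ∀ a b (P : ℂ[X][X]), φ a b P = (P.map (Polynomial.evalRingHom a)).eval b := by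
    intro a b P; rfl
  have hF1' : F.natDegree ≠ 0 := by omega
  -- every `F(c, ·)` is a nonzero polynomial
  have hFc : ∀ c : ℂ, F.map (Polynomial.evalRingHom c) ≠ 0 := by
    intro c hc
    obtain ⟨j, hj⟩ := exists_coeff_not_isRoot_of_irreducible hFirr hF1' c
    apply hj
    have h := congrArg (fun q : ℂ[X] => q.coeff j) hc
    simp only [Polynomial.coeff_map, Polynomial.coe_evalRingHom, Polynomial.coeff_zero] at h
    exact h
  -- `f` has positive degree: otherwise `F(c, a)` would not depend on `c`
  set m := f.natDegree with hm
  set n := g.natDegree with hn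
  have hm0 : m ≠ 0 := by
    intro hm0
    have hfC := Polynomial.eq_C_of_natDegree_eq_zero hm0
    -- a point `(c₀, a₀)` of the curve
    obtain ⟨c₀, hc₀⟩ := exists_eval_ne_zero F.leadingCoeff
      (Polynomial.leadingCoeff_ne_zero.2 hFirr.ne_zero)
    obtain ⟨a₀, ha₀⟩ : ∃ a₀ : ℂ, (F.map (Polynomial.evalRingHom c₀)).eval a₀ = 0 := by
      have hnd : (F.map (Polynomial.evalRingHom c₀)).natDegree = F.natDegree :=
        Polynomial.natDegree_map_of_leadingCoeff_ne_zero _ (by rwa [Polynomial.coe_evalRingHom])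
      have hdeg : (F.map (Polynomial.evalRingHom c₀)).degree ≠ 0 := by
        rw [Polynomial.degree_eq_natDegree (hFc c₀), hnd]
        exact_mod_cast hF1'
      obtain ⟨y, hy⟩ := IsAlgClosed.exists_root _ hdeg
      exact ⟨y, hy⟩
    obtain ⟨c, hc⟩ := hFh a₀
    apply hc
    rw [← hf a₀ 0 c, hfC, Polynomial.map_C, Polynomial.eval_C]
    have h0 := hf a₀ 0 c₀
    rw [hfC, Polynomial.map_C, Polynomial.eval_C] at h0
    rw [h0, ha₀]
  -- the eliminant
  set D : ℂ[X][X] := Polynomial.resultant f g m n with hD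
  obtain ⟨p, q, -, -, hpq⟩ := Polynomial.exists_mul_add_mul_eq_C_resultant f g
    (le_refl m) (le_refl n) (Or.inl hm0)
  have hpq' : f * p + g * q = Polynomial.C D := hpq
  refine ⟨D, ?_, ?_⟩
  swap
  · -- `D` vanishes at the common solutions
    intro a b c hFca hHcb
    have h := congrArg (fun P : Polynomial (ℂ[X][X]) => (P.map (φ a b)).eval c) hpq'
    simp only [Polynomial.map_add, Polynomial.map_mul, Polynomial.eval_add, Polynomial.eval_mul,
      Polynomial.map_C, Polynomial.eval_C] at h
    rw [hf, hg, hFca, hHcb, zero_mul, zero_mul, add_zero] at h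
    rw [← hφev, ← h]
  -- `D ≠ 0`: specialise at a good point `(a, b)`
  intro hD0
  have hf0 : f ≠ 0 := fun h => hm0 (by rw [hm, h, Polynomial.natDegree_zero])
  have hg0 : g ≠ 0 := by
    intro h
    -- `H ≠ 0` gives a point where `H(c, b) ≠ 0`
    obtain ⟨j, hj⟩ : ∃ j, H.coeff j ≠ 0 := by
      by_contra hall; push Not at hall
      exact hH (Polynomial.ext fun j => by rw [hall j, Polynomial.coeff_zero])
    obtain ⟨c, hc⟩ := exists_eval_ne_zero _ hj
    have hHc : H.map (Polynomial.evalRingHom c) ≠ 0 := by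
      intro h0
      have := congrArg (fun q : ℂ[X] => q.coeff j) h0
      simp only [Polynomial.coeff_map, Polynomial.coe_evalRingHom, Polynomial.coeff_zero] at this
      exact hc this
    obtain ⟨b, hb⟩ := exists_eval_ne_zero _ hHc
    apply hb
    rw [← hg 0 b c, h, Polynomial.map_zero, Polynomial.eval_zero]
  have hlcf : f.leadingCoeff ≠ 0 := Polynomial.leadingCoeff_ne_zero.2 hf0
  have hlcg : g.leadingCoeff ≠ 0 := Polynomial.leadingCoeff_ne_zero.2 hg0
  -- finitely many bad `a`
  set A₁ : Set ℂ := {a | f.leadingCoeff.map (Polynomial.evalRingHom a) = 0} with hA₁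
  set A₃ : Set ℂ := {a | g.leadingCoeff.map (Polynomial.evalRingHom a) = 0} with hA₃
  set T : Set ℂ := {c | H.map (Polynomial.evalRingHom c) = 0} with hT
  set A₂ : Set ℂ := ⋃ c ∈ T, {a | (F.map (Polynomial.evalRingHom c)).IsRoot a} with hA₂
  have hA₁f : A₁.Finite := finite_setOf_rows_eq_zero _ hlcf
  have hA₃f : A₃.Finite := finite_setOf_rows_eq_zero _ hlcg
  have hTf : T.Finite := finite_setOf_rows_eq_zero _ hH
  have hA₂f : A₂.Finite := hTf.biUnion fun c _ => Polynomial.finite_setOf_isRoot (hFc c)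
  obtain ⟨a, ha⟩ := ((hA₁f.union hA₃f).union hA₂f).infinite_compl.nonempty
  simp only [Set.mem_compl_iff, Set.mem_union, not_or] at ha
  obtain ⟨⟨ha₁, ha₃⟩, ha₂⟩ := ha
  -- the specialised `f` does not depend on `b`
  set Fa : ℂ[X] := f.map (φ a 0) with hFa
  have hFab : ∀ b, f.map (φ a b) = Fa := by
    intro b
    refine Polynomial.funext fun c => ?_
    rw [hFa, hf, hf]
  have hFaev : ∀ c, Fa.eval c = (F.map (Polynomial.evalRingHom c)).eval a := fun c => by rw [hFa, hf]
  -- its degree is `m`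
  obtain ⟨b₀, hb₀⟩ := exists_eval_ne_zero _ ha₁
  have hFam : Fa.coeff m = (f.leadingCoeff.map (Polynomial.evalRingHom a)).eval b₀ := by
    rw [← hFab b₀, Polynomial.coeff_map, ← hφev]; rfl
  have hFam0 : Fa.coeff m ≠ 0 := by rw [hFam]; exact hb₀
  have hFa0 : Fa ≠ 0 := fun h => hFam0 (by rw [h, Polynomial.coeff_zero])
  have hFadeg : Fa.natDegree = m := by
    refine le_antisymm ?_ (Polynomial.le_natDegree_of_ne_zero hFam0)
    rw [hFa]; exact Polynomial.natDegree_map_le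
  -- finitely many bad `b`
  set B₂ : Set ℂ := {b | (g.leadingCoeff.map (Polynomial.evalRingHom a)).IsRoot b} with hB₂
  set B₁ : Set ℂ := ⋃ c ∈ {c : ℂ | Fa.IsRoot c}, {b | (H.map (Polynomial.evalRingHom c)).IsRoot b}
    with hB₁
  have hB₂f : B₂.Finite := Polynomial.finite_setOf_isRoot ha₃
  have hHc : ∀ c, Fa.IsRoot c → H.map (Polynomial.evalRingHom c) ≠ 0 := by
    intro c hc hzero
    apply ha₂
    rw [hA₂, Set.mem_iUnion₂]
    refine ⟨c, hzero, ?_⟩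
    rw [Set.mem_setOf_eq, Polynomial.IsRoot, ← hFaev]
    exact hc
  have hB₁f : B₁.Finite :=
    (Polynomial.finite_setOf_isRoot hFa0).biUnion fun c hc => Polynomial.finite_setOf_isRoot (hHc c hc)
  obtain ⟨b, hb⟩ := (hB₂f.union hB₁f).infinite_compl.nonempty
  simp only [Set.mem_compl_iff, Set.mem_union, not_or] at hb
  obtain ⟨hb₂, hb₁⟩ := hb
  -- the specialised `g`
  set Gb : ℂ[X] := g.map (φ a b) with hGb
  have hGbn : Gb.coeff n = (g.leadingCoeff.map (Polynomial.evalRingHom a)).eval b := by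
    rw [hGb, Polynomial.coeff_map, ← hφev]; rfl
  have hGbn0 : Gb.coeff n ≠ 0 := by rw [hGbn]; exact hb₂
  have hGbdeg : Gb.natDegree = n := by
    refine le_antisymm ?_ (Polynomial.le_natDegree_of_ne_zero hGbn0)
    rw [hGb]; exact Polynomial.natDegree_map_le
  -- no common root
  have hcop : IsCoprime Fa Gb := by
    refine (Polynomial.isCoprime_iff_aeval_ne_zero_of_isAlgClosed ℂ ℂ Fa Gb).2 fun c => ?_
    by_cases hc : Fa.IsRoot c
    · right
      have hbc : ¬ (H.map (Polynomial.evalRingHom c)).IsRoot b := by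
        intro hroot
        apply hb₁
        rw [hB₁, Set.mem_iUnion₂]
        exact ⟨c, hc, hroot⟩
      rw [Polynomial.coe_aeval_eq_eval, hGb, hg]
      exact fun h => hbc h
    · left
      rw [Polynomial.coe_aeval_eq_eval]
      exact hc
  have hres : Polynomial.resultant Fa Gb ≠ 0 := by
    intro h
    rw [Polynomial.resultant_eq_zero_iff] at h
    exact h.2 hcop
  apply hres
  have : Polynomial.resultant Fa Gb = Polynomial.resultant Fa Gb m n := by
    rw [← hFadeg, ← hGbdeg]
  rw [this, ← hFab b, hGb, Polynomial.resultant_map_map]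
  change (φ a b) D = 0
  rw [hD0, map_zero]


/-! ## Part B. Transcendence of `e^{x₁}` along a bounded branch -/

/-- **Along a non-constant bounded branch of a curve containing no horizontal line, `e^{x₁}`
satisfies no algebraic relation with `x₀`** (file LXVII's lemma with `deg_{x₁} F ≥ 2` replaced by
"no horizontal line": if the branch were constant `= θ`, `F(·, θ)` would vanish along
`x₀ = u^{-k} → ∞`, hence identically). [folklore] (new in this form) -/
theorem not_eventually_relation_exp_boundedBranch' (hFirr : Irreducible F) (hF1 : 1 ≤ F.natDegree)
    (hFh : ∀ a : ℂ, ∃ c : ℂ, (F.map (Polynomial.evalRingHom c)).eval a ≠ 0)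
    {k : ℕ} (hk : 1 ≤ k) {Φ : ℂ → ℂ} (hΦan : AnalyticAt ℂ Φ 0)
    (hplace : ∀ᶠ s in 𝓝[≠] (0 : ℂ), (F.map (Polynomial.evalRingHom (s ^ k)⁻¹)).eval (Φ s) = 0)
    (H : ℂ[X][X]) (hH : H ≠ 0) :
    ¬ ∀ᶠ u in 𝓝[≠] (0 : ℂ),
      (H.map (Polynomial.evalRingHom ((fun _ : ℂ => (1 : ℂ)) u * u⁻¹ ^ k))).eval
        (Complex.exp (Φ u)) = 0 := by
  classical
  intro hrel
  -- the eliminant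
  obtain ⟨D, hD0, hDvan⟩ := exists_eliminant_of_not_horizontal F H hFirr hF1 hFh hH _ _
    (eval_swapToX1 F) (eval_swapToY1 H)
  -- `D(Φ u, e^{Φ u}) = 0` near `0`
  set gD : ℂ → ℂ := fun z => ∑ j ∈ Finset.range (D.natDegree + 1),
    (D.coeff j).eval z * Complex.exp z ^ j with hgD
  have hgDev : ∀ z, gD z = (D.map (Polynomial.evalRingHom z)).eval (Complex.exp z) := by
    intro z; rw [hgD, evalPP_eq_sum D z _ (Nat.lt_succ_self _)]
  have hgDan : AnalyticOnNhd ℂ gD Set.univ := by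
    intro z _
    rw [hgD]
    refine Finset.analyticAt_fun_sum _ fun j _ => ?_
    exact (analyticAt_polynomial_eval_comp analyticAt_id _).mul (analyticAt_cexp.pow j)
  have hrelD : ∀ᶠ u in 𝓝[≠] (0 : ℂ), gD (Φ u) = 0 := by
    filter_upwards [hplace, hrel, self_mem_nhdsWithin] with u hF hHu (hu : u ≠ 0)
    rw [one_mul, inv_pow] at hHu
    rw [hgDev]
    exact hDvan (Φ u) (Complex.exp (Φ u)) ((u ^ k)⁻¹) hF hHu
  -- the branch is not horizontal
  set θ : ℂ := Φ 0 with hθ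
  have hΦne : ∀ᶠ u in 𝓝[≠] (0 : ℂ), Φ u ≠ θ := by
    rcases (hΦan.sub (analyticAt_const : AnalyticAt ℂ (fun _ : ℂ => θ) 0)).eventually_eq_zero_or_eventually_ne_zero
      with h | h
    · exfalso
      -- `F(·, θ)` would vanish along `x₀ = u^{-k} → ∞`, hence identically: a horizontal line in `C`
      set P : ℂ[X] := F.eval (Polynomial.C θ) with hP
      have hx₀ : Tendsto (fun u : ℂ => ‖(u ^ k)⁻¹‖) (𝓝[≠] (0 : ℂ)) atTop := by
        have h1 : Tendsto (fun u : ℂ => u ^ k) (𝓝[≠] (0 : ℂ)) (𝓝[≠] 0) := by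
          refine tendsto_nhdsWithin_iff.2 ⟨?_, ?_⟩
          · have : Tendsto (fun u : ℂ => u ^ k) (𝓝 (0 : ℂ)) (𝓝 (0 ^ k)) :=
              (continuous_pow k).continuousAt.tendsto
            rw [zero_pow (by omega)] at this
            exact this.mono_left nhdsWithin_le_nhds
          · filter_upwards [self_mem_nhdsWithin] with u hu
            exact pow_ne_zero _ hu
        exact (tendsto_norm_inv_nhdsNE_zero_atTop (α := ℂ)).comp h1
      have hP0 : P = 0 := by
        by_contra hP0
        have hev := eventually_eval_ne_zero_of_tendsto_norm hP0 hx₀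
        obtain ⟨u, ⟨hu1, hu2⟩, hu3⟩ :=
          ((hev.and hplace).and (eventually_nhdsWithin_of_eventually_nhds h)).exists
        apply hu1
        rw [hP, eval_eval_C]
        have hu3' : Φ u = θ := by simpa [sub_eq_zero] using hu3
        rw [← hu3']
        exact hu2
      obtain ⟨c, hc⟩ := hFh θ
      apply hc
      rw [← eval_eval_C, ← hP, hP0, Polynomial.eval_zero]
    · filter_upwards [h] with u hu
      simpa [sub_eq_zero] using hu
  have hΦtend : Tendsto Φ (𝓝[≠] (0 : ℂ)) (𝓝[≠] θ) :=
    tendsto_nhdsWithin_iff.2 ⟨(hΦan.continuousAt.tendsto).mono_left nhdsWithin_le_nhds, hΦne⟩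
  have hfreq : ∃ᶠ z in 𝓝[≠] θ, gD z = 0 := hΦtend.frequently hrelD.frequently
  have hzero := hgDan.eqOn_zero_of_preconnected_of_frequently_eq_zero isPreconnected_univ
    (Set.mem_univ θ) hfreq
  obtain ⟨z, hz⟩ := exists_exp_relation_ne_zero D hD0
  apply hz
  rw [← hgDev]
  exact hzero (Set.mem_univ z)

/-! ## Part C. The engine for curves of any positive `x₁`-degree -/

/-- **THEOREM (bounded branches, any positive `x₁`-degree).**  `F ∈ ℂ[x₀][x₁]` irreducible of
positive `x₁`-degree whose curve contains no horizontal line; a bounded place at infinity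
`F(s^{-k}, Φ(s)) = 0` (`k ≥ 1`, `Φ` analytic at `0`); a fibre value `ψ(s)s^L` with `ψ` analytic,
`ψ(0) ≠ 0`.  Every irreducible closed `S ⊆ ℂ² × ℂ²` of dimension `≤ 2` containing the germ
`(s^{-k}, Φ(s), ψ(s)s^L, e^{Φ(s)})` (small `s ≠ 0`) has Zariski-dense exponential points — with NO
direction condition. [cite: MantovaMasser2023, §1 Further remarks, p. 5 (the question, open in
general)] (new) -/
theorem unprojectedDense_boundedBranch' {S : Set (Fin 2 ⊕ Fin 2 → ℂ)} (hS : IsIrreducibleClosed ℂ S)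
    (hdim : zariskiDim ℂ S ≤ (2 : ℕ)) (hFirr : Irreducible F) (hF1 : 1 ≤ F.natDegree)
    (hFh : ∀ a : ℂ, ∃ c : ℂ, (F.map (Polynomial.evalRingHom c)).eval a ≠ 0)
    {k : ℕ} (hk : 1 ≤ k) {Φ : ℂ → ℂ} (hΦan : AnalyticAt ℂ Φ 0)
    (hplace : ∀ᶠ s in 𝓝[≠] (0 : ℂ), (F.map (Polynomial.evalRingHom (s ^ k)⁻¹)).eval (Φ s) = 0)
    (L : ℤ) {ψ : ℂ → ℂ} (hψan : AnalyticAt ℂ ψ 0) (hψ0 : ψ 0 ≠ 0)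
    (hgerm : ∀ᶠ s in 𝓝[≠] (0 : ℂ),
      (Sum.elim ![(s ^ k)⁻¹, Φ s] ![ψ s * s ^ L, Complex.exp (Φ s)] : Fin 2 ⊕ Fin 2 → ℂ) ∈ S) :
    UnprojectedDense S := by
  classical
  have hk0 : k ≠ 0 := by omega
  obtain ⟨z, hz⟩ := IsAlgClosed.exists_pow_nat_eq (2 * Real.pi * I : ℂ) (by omega : 0 < k)
  obtain ⟨N₀, u, s, -, -, -, -, -, -, -, -, hs0, hs, hexp⟩ := exists_poleFibre_expPoints hk L hψan hψ0 hz
  have hsW : Tendsto s atTop (𝓝[≠] (0 : ℂ)) :=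
    tendsto_nhdsWithin_iff.2 ⟨hs, Eventually.of_forall hs0⟩
  obtain ⟨J₀, hJ₀⟩ := Filter.eventually_atTop.1 (hsW.eventually hgerm)
  set p : ℕ → Fin 2 ⊕ Fin 2 → ℂ := fun m =>
    Sum.elim ![(s (J₀ + m) ^ k)⁻¹, Φ (s (J₀ + m))]
      ![ψ (s (J₀ + m)) * s (J₀ + m) ^ L, Complex.exp (Φ (s (J₀ + m)))] with hp
  have hpS : ∀ m, p m ∈ S := fun m => hJ₀ (J₀ + m) (Nat.le_add_right _ _)
  have hpΓ : ∀ m, p m ∈ expGraph ℂ 2 := by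
    intro m
    rw [mem_expGraph_iff]
    intro i
    rw [Literature.ModelTheory.ExponentialFields.ExponentialRing.complex_exp_eq]
    fin_cases i
    · simp [hp, hexp (J₀ + m)]
    · simp [hp]
  have hsJ : Tendsto (fun m => s (J₀ + m)) atTop (𝓝 0) :=
    hs.comp ((tendsto_add_atTop_nat J₀).congr fun m => by ring)
  have hsJ0 : ∀ m, s (J₀ + m) ≠ 0 := fun m => hs0 _
  have hnorm : Tendsto (fun m => ‖p m (Sum.inl 0)‖) atTop atTop := by
    have h1 : Tendsto (fun m => ‖s (J₀ + m) ^ k‖) atTop (𝓝[>] 0) := by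
      refine tendsto_nhdsWithin_iff.2 ⟨?_, Eventually.of_forall fun m => ?_⟩
      · have h0 : Tendsto (fun m => s (J₀ + m) ^ k) atTop (𝓝 0) := by
          simpa [zero_pow hk0] using hsJ.pow k
        simpa using h0.norm
      · exact norm_pos_iff.2 (pow_ne_zero _ (hsJ0 m))
    have h2 := tendsto_inv_nhdsGT_zero.comp h1
    refine h2.congr fun m => ?_
    simp [hp, norm_inv]
  refine unprojectedDense_of_transcendental_relation_pole hS hdim 0 1 hpS hpΓ hnorm
    (U := fun _ => (1 : ℂ)) (w := fun v => Complex.exp (Φ v)) analyticAt_const hΦan.cexp k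
    (μ := fun m => s (J₀ + m)) hsJ0 hsJ (fun m => ?_) (fun m => ?_) ?_
  · simp [hp, inv_pow]
  · simp [hp]
  · exact not_eventually_relation_exp_boundedBranch' F hFirr hF1 hFh hk hΦan hplace



/-- **Rational fibres along a bounded branch, any positive `x₁`-degree.**  `F` irreducible of
positive `x₁`-degree whose curve contains no horizontal line; a bounded place `F(s^{-k}, Φ(s)) = 0`;
`R, Q ∈ ℂ[x₀, x₁]` nonzero somewhere on the curve; `S` irreducible closed of dimension `≤ 2`
containing `(x, R(x)/Q(x), e^{x₁})` for all `x` on the curve with `Q(x) ≠ 0`: `S` has Zariski-dense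
exponential points (file LXVII (b)'s theorem without `deg_{x₁} F ≥ 2`). [cite: MantovaMasser2023,
§1 Further remarks, p. 5 (the question, open in general)] (new) -/
theorem unprojectedDense_planeCurve_rationalFibre_boundedPlace' (hFirr : Irreducible F)
    (hF1 : 1 ≤ F.natDegree) (hFh : ∀ a : ℂ, ∃ c : ℂ, (F.map (Polynomial.evalRingHom c)).eval a ≠ 0)
    {k : ℕ} (hk : 1 ≤ k) {Φ : ℂ → ℂ} (hΦan : AnalyticAt ℂ Φ 0)
    (hplace : ∀ᶠ s in 𝓝[≠] (0 : ℂ), (F.map (Polynomial.evalRingHom (s ^ k)⁻¹)).eval (Φ s) = 0)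
    (R Q : MvPolynomial (Fin 2) ℂ)
    (hR : ∃ x y : ℂ, (F.map (Polynomial.evalRingHom x)).eval y = 0 ∧ MvPolynomial.eval ![x, y] R ≠ 0)
    (hQ : ∃ x y : ℂ, (F.map (Polynomial.evalRingHom x)).eval y = 0 ∧ MvPolynomial.eval ![x, y] Q ≠ 0)
    {S : Set (Fin 2 ⊕ Fin 2 → ℂ)} (hS : IsIrreducibleClosed ℂ S) (hdim : zariskiDim ℂ S ≤ (2 : ℕ))
    (hsub : ∀ x y : ℂ, (F.map (Polynomial.evalRingHom x)).eval y = 0 →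
      MvPolynomial.eval ![x, y] Q ≠ 0 →
      (Sum.elim ![x, y] ![MvPolynomial.eval ![x, y] R / MvPolynomial.eval ![x, y] Q, Complex.exp y] :
        Fin 2 ⊕ Fin 2 → ℂ) ∈ S) :
    UnprojectedDense S := by
  classical
  obtain ⟨Φr, hΦr⟩ := exists_rowsEquiv
  have hndvdR : ¬ F ∣ Φr R := by
    refine not_dvd_of_exists_eval_ne_zero F ?_
    obtain ⟨x, y, hxy, hne⟩ := hR
    exact ⟨x, y, hxy, by rw [← hΦr]; exact hne⟩
  have hndvdQ : ¬ F ∣ Φr Q := by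
    refine not_dvd_of_exists_eval_ne_zero F ?_
    obtain ⟨x, y, hxy, hne⟩ := hQ
    exact ⟨x, y, hxy, by rw [← hΦr]; exact hne⟩
  have hplace' : ∀ᶠ s in 𝓝[≠] (0 : ℂ),
      (F.map (Polynomial.evalRingHom (s ^ k)⁻¹)).eval (Φ s * (s ^ 0)⁻¹) = 0 := by
    filter_upwards [hplace] with s hs
    rwa [pow_zero, inv_one, mul_one]
  obtain ⟨ψR, LR, hψRan, hψR0, hfR⟩ :=
    exists_rows_place_normalForm F hFirr hF1 (Φr R) hndvdR hk 0 hΦan hplace'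
  obtain ⟨ψQ, LQ, hψQan, hψQ0, hfQ⟩ :=
    exists_rows_place_normalForm F hFirr hF1 (Φr Q) hndvdQ hk 0 hΦan hplace'
  have hψQne : ∀ᶠ s in 𝓝 (0 : ℂ), ψQ s ≠ 0 := hψQan.continuousAt.eventually_ne hψQ0
  refine unprojectedDense_boundedBranch' F hS hdim hFirr hF1 hFh hk hΦan hplace (LR - LQ)
    (hψRan.div hψQan hψQ0) (div_ne_zero hψR0 hψQ0) ?_
  filter_upwards [hplace, hfR, hfQ, self_mem_nhdsWithin, nhdsWithin_le_nhds hψQne] with s hs hsR hsQ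
    (hs0 : s ≠ 0) hψQs
  rw [pow_zero, inv_one, mul_one] at hsR hsQ
  have hQne : MvPolynomial.eval ![(s ^ k)⁻¹, Φ s] Q ≠ 0 := by
    rw [hΦr, hsQ]
    exact mul_ne_zero hψQs (zpow_ne_zero _ hs0)
  have hmem := hsub _ _ hs hQne
  have hval : MvPolynomial.eval ![(s ^ k)⁻¹, Φ s] R / MvPolynomial.eval ![(s ^ k)⁻¹, Φ s] Q =
      ψR s / ψQ s * s ^ (LR - LQ) := by
    rw [hΦr, hΦr, hsR, hsQ, zpow_sub₀ hs0]
    field_simp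
  rw [hval] at hmem
  exact hmem

end BoundedBranchGeneral

end Summit.Schanuel.Schanuel.Theorems

end
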